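import Mathlib
import Literature.NumberTheory.EllipticCurves.HeegnerPoints
import Literature.NumberTheory.EllipticCurves.AnalyticRank
import Literature.NumberTheory.EllipticCurves.QuadraticTwist
import Literature.NumberTheory.EllipticCurves.BSDSelmerCMPConverseGoldfeldProofs
import Literature.NumberTheory.EllipticCurves.AnalyticRankOrderProofs

/-!
# Transfer lens g23 (seat bsd-idea-18) — CORRECTION to memo `R8-X12-bsd-idea-18-g20.md` §5

Crux `HeegnerTwistCouplingInSupply` (stmt-BirchSwinnertonDyer-21381), `j = 0` / X12 corner.
Memo g20 §5 (l. 116) asserted «Burungale–Tian-type converses are for `p ∤ 6N`», and the banked corner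
shape (critic V#17h (2), director-bsd 18:22:50Z) therefore records the elliptic-curve half (J0-L8) as
necessarily ANALYTIC.  That premise is false: Burungale–Tian, Ann. of Math. 203 (2026) Thm 1.1
(= arXiv:2506.03465, Thm 3.1 for every CM newform) is uniform in the prime — ANY CM curve over `ℚ`,
ANY prime `p`, no reduction hypothesis — and is the tree's named fact
`burungaleTian_analyticRank_eq_zero_of_selmerCorank_eq_zero_of_hasCM` (already a HELD print input of
the line of record `Lines/size_tail.lean`, `stub_printedInputsDensityOne`, and of the `j = 1728`,
`j = 8000` corner theorems).  Hence (J0-L8) follows from the purely ALGEBRAIC second-`2`-descent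
statement (J0-S8) below — kernel-checked here (`j0L8Rank_of_BT`, `j0L8_of_rank`), sorry-free.
Nothing here is an item, a stub or a skeleton (W-71/W-79); `J0S8` is NOT proved.  BSD is not proved
by any of this.
-/

set_option linter.dupNamespace false

namespace Summit.BirchSwinnertonDyer.BirchSwinnertonDyer.Cruxes.HeegnerTwistCouplingInSupply.TransferG23

open Literature.NumberTheory.EllipticCurves WeierstrassCurve

/-! ### Verbatim copies of the g20 `Prop`s (`SketchTransferG20.lean`, commit 7735fdff6c55; the Cruxes
module is not a built import target on the farm, hence copied, not imported). -/

/-- The X12 corner parameters: primes `p ≡ 11 (mod 12)`, `ℓ ≡ 23 (mod 24)` with `(ℓ/p) = −1`. -/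
def IsX12Pair (p ℓ : ℕ) : Prop :=
  p.Prime ∧ ℓ.Prime ∧ p % 12 = 11 ∧ ℓ % 24 = 23 ∧ jacobiSym (ℓ : ℤ) p = -1

/-- `36a1 : y² = x³ + 1`; `E36.quadraticTwist M = ⟨0,0,0,0,M³⟩ = y² = x³ + M³`. -/
def E36 : WeierstrassCurve ℚ := ⟨0, 0, 0, 0, 1⟩

/-- **(J0-L8)** of memo g20 (`L`-value form): `16 ∤ h(−3pℓ)` ⟹ `L(E_{pℓ}, 1) ≠ 0`. -/
def J0L8 : Prop :=
  ∀ (p ℓ : ℕ), IsX12Pair p ℓ →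
  ∀ (K : Type) [Field K] [NumberField K], IsImaginaryQuadratic K →
    NumberField.discr K = -(3 * p * ℓ : ℤ) → ¬ 16 ∣ NumberField.classNumber K →
    (E36.quadraticTwist ((p : ℚ) * ℓ)).entireLFunction 1 ≠ 0

/-- `36a1 : y² = x³ + 1` is an elliptic curve (`Δ = −432`). -/
theorem E36_isElliptic : E36.IsElliptic := by
  refine ⟨?_⟩
  rw [isUnit_iff_ne_zero]
  norm_num [E36, WeierstrassCurve.Δ, WeierstrassCurve.b₂, WeierstrassCurve.b₄,
    WeierstrassCurve.b₆, WeierstrassCurve.b₈]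

/-- `j(36a1) = 0`. -/
theorem E36_j : @WeierstrassCurve.j ℚ _ E36 E36_isElliptic = 0 := by
  letI := E36_isElliptic
  rw [WeierstrassCurve.j]
  norm_num [E36, WeierstrassCurve.c₄, WeierstrassCurve.b₂, WeierstrassCurve.b₄]

/-- `36a1` has complex multiplication (`j = 0 ∈ maximalCMJInvariants`; tree theorem
`hasCM_of_j_mem_maximalCMJInvariants_holds`). -/
theorem E36_hasCM : E36.HasCM := by
  letI := E36_isElliptic
  refine hasCM_of_j_mem_maximalCMJInvariants_holds E36 ?_
  rw [E36_j]
  simp [maximalCMJInvariants]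

/-- For an X12 pair the twisting parameter `pℓ` is a non-zero rational. -/
theorem twistParam_ne_zero {p ℓ : ℕ} (h : IsX12Pair p ℓ) : ((p : ℚ) * ℓ) ≠ 0 := by
  have hp : (p : ℚ) ≠ 0 := by exact_mod_cast h.1.ne_zero
  have hl : (ℓ : ℚ) ≠ 0 := by exact_mod_cast h.2.1.ne_zero
  exact mul_ne_zero hp hl

/-- **(J0-S8)** — the SECOND-`2`-DESCENT half (open; numerically g20's 50/50 with
`Ш_an[2^∞] ≅ (ℤ/2)²` exactly when `r₈ = 0`).  For an X12 pair and `16 ∤ h(−3pℓ)` (i.e.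
`r₈(Cl ℚ(√−3pℓ)) = 0`), the `2^∞`-Selmer group of `E_{pℓ} = (36a1)^{(pℓ)} : y² = x³ + (pℓ)³` has
`ℤ₂`-corank `0`.  Mechanism (template, full-`2`-torsion sibling): `dim Sel₂ = 3 = 1 (torsion) + 2`,
and the Cassels–Tate pairing on the `2`-dimensional quotient is non-degenerate iff `r₈ = 0`
(engine: Cassels 1998 second descent for a rational `2`-torsion point; sibling instances
Ouyang–Zhang 2015, Wang 2016 for `y² = x³ − n²x`).  No `Fact (Nat.Prime 2)` binder is needed by
`selmerCorank`. -/
def J0S8 : Prop :=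
  ∀ (p ℓ : ℕ), IsX12Pair p ℓ →
  ∀ (K : Type) [Field K] [NumberField K], IsImaginaryQuadratic K →
    NumberField.discr K = -(3 * p * ℓ : ℤ) → ¬ 16 ∣ NumberField.classNumber K →
    (E36.quadraticTwist ((p : ℚ) * ℓ)).selmerCorank 2 = 0

/-- **(J0-L8), analytic-rank form**: same hypotheses, conclusion `r_an(E_{pℓ}) = 0`. -/
def J0L8Rank : Prop :=
  ∀ (p ℓ : ℕ), IsX12Pair p ℓ →
  ∀ (K : Type) [Field K] [NumberField K], IsImaginaryQuadratic K →
    NumberField.discr K = -(3 * p * ℓ : ℤ) → ¬ 16 ∣ NumberField.classNumber K →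
    (E36.quadraticTwist ((p : ℚ) * ℓ)).analyticRank = 0

/-- **(J0-L8) ⇐ Burungale–Tian 2026 Thm 1.1 (p = 2) + (J0-S8).**  The `2`-converse is the tree's
named fact, taken as a hypothesis exactly as the line of record does; `E_{pℓ}` is CM because
quadratic twists of the CM curve `36a1` are CM (`hasCM_quadraticTwist_of_hasCM`, proved in the tree). -/
theorem j0L8Rank_of_BT
    (hBT : burungaleTian_analyticRank_eq_zero_of_selmerCorank_eq_zero_of_hasCM)
    (hS : J0S8) : J0L8Rank := by
  intro p ℓ hpl K _ _ hK hdisc h16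
  letI : E36.IsElliptic := E36_isElliptic
  have hd : ((p : ℚ) * ℓ) ≠ 0 := twistParam_ne_zero hpl
  letI := E36.isElliptic_quadraticTwist hd
  haveI : Fact (Nat.Prime 2) := ⟨Nat.prime_two⟩
  have hCM : (E36.quadraticTwist ((p : ℚ) * ℓ)).HasCM :=
    hasCM_quadraticTwist_of_hasCM E36 E36_hasCM hd
  exact hBT (E36.quadraticTwist ((p : ℚ) * ℓ)) hCM 2 (hS p ℓ hpl K hK hdisc h16)

/-- **(J0-L8) in the `L`-value form of memo g20** (`L(E_{pℓ}, 1) ≠ 0`), from the rank form and the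
tree's proved `analyticRank_eq_zero_iff_holds`, given an entire continuation of `L(E_{pℓ}, s)`
(`hEnt`; discharged by Deuring for CM curves / by modularity, `IsNewformOf.hasEntireLFunction`). -/
theorem j0L8_of_rank
    (hEnt : ∀ (M : ℚ), M ≠ 0 → (E36.quadraticTwist M).HasEntireLFunction)
    (h : J0L8Rank) : J0L8 := by
  intro p ℓ hpl K _ _ hK hdisc h16
  letI : E36.IsElliptic := E36_isElliptic
  have hd : ((p : ℚ) * ℓ) ≠ 0 := twistParam_ne_zero hpl
  letI := E36.isElliptic_quadraticTwist hd
  exact ((E36.quadraticTwist ((p : ℚ) * ℓ)).analyticRank_eq_zero_iff_holds (hEnt _ hd)).mp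
    (h p ℓ hpl K hK hdisc h16)

/-- The corrected corner chain in one line: BT `2`-converse + second descent + continuation ⟹ (J0-L8). -/
theorem j0L8_of_BT_of_J0S8
    (hBT : burungaleTian_analyticRank_eq_zero_of_selmerCorank_eq_zero_of_hasCM)
    (hEnt : ∀ (M : ℚ), M ≠ 0 → (E36.quadraticTwist M).HasEntireLFunction)
    (hS : J0S8) : J0L8 :=
  j0L8_of_rank hEnt (j0L8Rank_of_BT hBT hS)

end Summit.BirchSwinnertonDyer.BirchSwinnertonDyer.Cruxes.HeegnerTwistCouplingInSupply.TransferG23
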